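import Mathlib
import Literature.NumberTheory.Sieve.BatemanHornProofs
import Summits.Parity.BatemanHorn.Theorems.IsogenyRedeiPolyMobiusTailStubEventuallyTwoLe
import Summits.Parity.BatemanHorn.Theorems.PolyMobiusTail.Negative.Structure
import Literature.NumberTheory.LFunctions.PolynomialRootMoebiusShortInterval
import Summits.Parity.BatemanHorn.Theorems.IsogenyRedeiPolyMobiusTailStubStripFinOneA
import Summits.Parity.BatemanHorn.Theorems.IsogenyRedeiPolyMobiusTailStubSignedTypeIOfKernelAux

/-!
# Crux `PolyMobiusTail` (stmt-Parity-0870), line `Sketch` (natural form): stub `stub_strip`, case `k = 1` — file B (inputs and `Fin 1` reductions)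

The registered stub `stub_strip_fin_one` of the lead's skeleton
`Summits/Parity/BatemanHorn/Cruxes/PolyMobiusTail/Lines/Sketch.lean` (the natural tail of a ONE-member
Bateman–Horn system between the cut-offs `x^{1-η}` and `x/(log x)^4` sums to `o(x)`) is proved in four
files (`…StubStripFinOne{A,B,C,}.lean`, worker of the line lead prover-line-stmt-Parity-0870-0); the
head theorem of each helper file is a registered auxiliary stub (`stub_core_fin_one`, `stub_U_identity`,
`stub_strip_fin_one_raw_bound`) so that it lands under the gate's stub-match rule.  Inputs from the tree:
Landau's theorem for `Σ μ(n)ρ_g(n)/n` in M-form with rate `(log x)^{-2}`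
(`Literature.NumberTheory.LFunctions.abs_sum_moebius_rootCount_div_le`) and the short-interval mass of
`|μρ_g|` (`…MoebiusRootCount.shortInterval_abs_moebius_mul_rootCount_le`).

This file: the mean value `Σ_{e≤Y} |μ(e)|ρ_g(e) ≤ A·Y` (from the tree's short-interval theorem), growth
and eventual monotonicity of `g(n)`, the threshold, the `Fin 1` reductions of the crux's divisor-tuple
sums, and the `U`-form identity `stub_U_identity` (registered auxiliary stub).
-/

open scoped BigOperators
open Filter Finset Polynomial Asymptotics

namespace Summit.Parity.BatemanHorn.Theorems.PolyMobiusTail.NaturalForm.StripFinOne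

open Literature.NumberTheory.Sieve

/-! ### Inputs: mean value, growth, threshold -/



/-- **Mean value of the root count on squarefrees** (`RootCountMeanValue` of the analysis):
`Σ_{e ≤ Y} |μ(e)| ρ_g(e) ≤ A·Y`, from the tree's short-interval mass of `|μρ_g|`
(`MoebiusRootCount.shortInterval_abs_moebius_mul_rootCount_le` at `x = 1`). [folklore] -/
theorem sum_abs_moebius_mul_rootCount_le {g : ℤ[X]} (hirr : Irreducible g) (hdeg : 0 < g.natDegree) :
    ∃ A : ℝ, 0 ≤ A ∧ ∀ Y : ℕ,
      ∑ e ∈ Icc 1 Y, |(ArithmeticFunction.moebius e : ℝ)| * (polyRootCountMod ![g] e : ℝ) ≤ A * Y := by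
  obtain ⟨A₁, A₂, θ, hA₁, hA₂, hθ, h⟩ :=
    Literature.NumberTheory.LFunctions.MoebiusRootCount.shortInterval_abs_moebius_mul_rootCount_le hirr hdeg
  refine ⟨A₁ + A₂ + 1, by positivity, fun Y => ?_⟩
  rcases Nat.eq_zero_or_pos Y with hY | hY
  · subst hY
    simp
  have hY1 : (1 : ℝ) ≤ Y := by exact_mod_cast hY
  have hsplit : ∑ e ∈ Icc 1 Y, |(ArithmeticFunction.moebius e : ℝ)| * (polyRootCountMod ![g] e : ℝ)
      = |(ArithmeticFunction.moebius 1 : ℝ)| * (polyRootCountMod ![g] 1 : ℝ)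
        + ∑ e ∈ Ioc 1 Y, |(ArithmeticFunction.moebius e : ℝ)| * (polyRootCountMod ![g] e : ℝ) := by
    have hI : Icc 1 Y = insert 1 (Ioc 1 Y) := by
      ext e
      simp only [Finset.mem_Icc, Finset.mem_insert, Finset.mem_Ioc]
      omega
    rw [hI, Finset.sum_insert (by simp)]
  have h1 : |(ArithmeticFunction.moebius 1 : ℝ)| * (polyRootCountMod ![g] 1 : ℝ) ≤ 1 := by
    rw [ArithmeticFunction.moebius_apply_one, Int.cast_one, abs_one, one_mul]
    exact_mod_cast polyRootCountMod_le _ 1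
  have h2 := h 1 Y le_rfl hY1
  rw [Nat.floor_one, Nat.floor_natCast] at h2
  have h2' : ∑ e ∈ Ioc 1 Y, |(ArithmeticFunction.moebius e : ℝ)| * (polyRootCountMod ![g] e : ℝ)
      ≤ A₁ * (Y - 1) + A₂ * (Y : ℝ) ^ θ := by
    refine le_trans (le_of_eq (Finset.sum_congr rfl fun e _ => ?_)) h2
    rw [abs_mul, Nat.abs_cast]
  have hθ' : (Y : ℝ) ^ θ ≤ Y := by
    calc (Y : ℝ) ^ θ ≤ (Y : ℝ) ^ (1 : ℝ) := Real.rpow_le_rpow_of_exponent_le hY1 hθ.le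
      _ = Y := Real.rpow_one _
  rw [hsplit]
  nlinarith

/-- Logarithmic growth of the values: `log g(n).toNat ≤ K log n` for `n ≥ 2`
(from `g(n).toNat ≤ (Σ|aⱼ|) n^{deg g} ≤ n^{Σ|aⱼ| + deg g}`). [folklore] -/
theorem log_toNat_eval_le (g : ℤ[X]) :
    ∃ K : ℕ, ∀ n : ℕ, 2 ≤ n → Real.log (((g.eval (n : ℤ)).toNat : ℕ) : ℝ) ≤ K * Real.log n := by
  set B : ℕ := ∑ j ∈ Finset.range (g.natDegree + 1), (g.coeff j).natAbs with hB
  refine ⟨B + g.natDegree, fun n hn => ?_⟩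
  have hle : (g.eval (n : ℤ)).toNat ≤ n ^ (B + g.natDegree) := by
    calc (g.eval (n : ℤ)).toNat ≤ B * n ^ g.natDegree := Negative.toNat_eval_le_mul_pow g (by omega)
      _ ≤ n ^ B * n ^ g.natDegree := by
          gcongr
          exact Nat.lt_two_pow_self.le.trans (Nat.pow_le_pow_left hn _)
      _ = n ^ (B + g.natDegree) := by rw [pow_add]
  rcases Nat.eq_zero_or_pos (g.eval (n : ℤ)).toNat with h0 | hpos
  · rw [h0, Nat.cast_zero, Real.log_zero]
    exact mul_nonneg (Nat.cast_nonneg _) (Real.log_nonneg (by exact_mod_cast (by omega : 1 ≤ n)))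
  · calc Real.log (((g.eval (n : ℤ)).toNat : ℕ) : ℝ)
        ≤ Real.log ((n : ℝ) ^ (B + g.natDegree)) := by
          refine Real.log_le_log (by exact_mod_cast hpos) ?_
          exact_mod_cast hle
      _ = _ := by rw [Real.log_pow, Nat.cast_add]

/-- A common threshold `N₀ ≥ 3` for a one-member Bateman–Horn system `(g)`: beyond it
`g(n).toNat ≥ 2` and `n ↦ g(n)` is non-decreasing. [folklore] -/
theorem threshold_fin_one {f : Fin 1 → ℤ[X]} (hf : IsBatemanHornSystem f) :
    ∃ N₀ : ℕ, 3 ≤ N₀ ∧ (∀ n, N₀ ≤ n → 2 ≤ ((f 0).eval (n : ℤ)).toNat) ∧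
      ∀ m n : ℕ, N₀ ≤ m → m ≤ n → (f 0).eval (m : ℤ) ≤ (f 0).eval (n : ℤ) := by
  obtain ⟨N₁, hN₁⟩ := stub_eventually_two_le 1 f hf
  obtain ⟨N₂, hN₂⟩ :=
    Summit.Parity.BatemanHorn.Theorems.PolyMobiusTail.NaturalForm.SignedTypeIAux.exists_monotone_eval
      (f 0) (Nat.succ_le_of_lt (hf.natDegree_pos 0)) (hf.leadingCoeff_pos 0)
  refine ⟨max 3 (max N₁ N₂), le_max_left _ _, fun n hn => hN₁ n ?_ 0, fun m n hm hmn => hN₂ m n ?_ hmn⟩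
  · exact (le_max_left _ _).trans ((le_max_right _ _).trans hn)
  · exact (le_max_right _ _).trans ((le_max_right _ _).trans hm)


/-! ### `Fin 1` reductions -/



/-- `Fin 1` bookkeeping: the natural-tail summand of a one-member family is a plain divisor sum.
[folklore] -/
theorem tail_fin_one (f : Fin 1 → ℤ[X]) (n : ℕ) (y : ℝ) :
    (∑ d ∈ Fintype.piFinset (fun i => (((f i).eval (n : ℤ)).toNat).divisors),
        if y < ∏ i, (d i : ℝ) then
          ∏ i, ((ArithmeticFunction.moebius (d i) : ℝ) *
            Real.log ((((f i).eval (n : ℤ)).toNat : ℝ) / (d i : ℝ))) else 0)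
    = ∑ e ∈ (((f 0).eval (n : ℤ)).toNat).divisors,
        if y < (e : ℝ) then (ArithmeticFunction.moebius e : ℝ) *
          Real.log ((((f 0).eval (n : ℤ)).toNat : ℝ) / (e : ℝ)) else 0 := by
  set F : ℕ → ℝ := fun e => if y < (e : ℝ) then (ArithmeticFunction.moebius e : ℝ) *
      Real.log ((((f 0).eval (n : ℤ)).toNat : ℝ) / (e : ℝ)) else 0 with hF
  have hfam : (fun i : Fin 1 => (((f i).eval (n : ℤ)).toNat).divisors)
      = fun _ => (((f 0).eval (n : ℤ)).toNat).divisors := by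
    funext i
    rw [Fin.fin_one_eq_zero i]
  have hterm : ∀ d : Fin 1 → ℕ, (if y < ∏ i, (d i : ℝ) then
      ∏ i, ((ArithmeticFunction.moebius (d i) : ℝ) *
        Real.log ((((f i).eval (n : ℤ)).toNat : ℝ) / (d i : ℝ))) else 0) = F (d 0) := by
    intro d
    simp only [hF, Fin.prod_univ_one]
  rw [Finset.sum_congr rfl fun d _ => hterm d, hfam,
    Fintype.sum_piFinset_apply F ((((f 0).eval (n : ℤ)).toNat).divisors) 0]
  simp

/-- The `k = 1` pointwise strip expansion: for `m : ℕ` and real cut-offs `y₁, y₂`,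
`tail(m,y₁) − tail(m,y₂) = log m · (Q₁(m,y₂) − Q₁(m,y₁)) − (Q₀(m,y₂) − Q₀(m,y₁))`,
`Q₁(m,y) = Σ_{e∣m, e≤y} μ(e)`, `Q₀(m,y) = Σ_{e∣m, e≤y} μ(e) log e`. [folklore] -/
theorem pointwise_fin_one (m : ℕ) (y₁ y₂ : ℝ) :
    (∑ e ∈ m.divisors, if y₁ < (e : ℝ) then
        (ArithmeticFunction.moebius e : ℝ) * Real.log ((m : ℝ) / (e : ℝ)) else 0)
      - (∑ e ∈ m.divisors, if y₂ < (e : ℝ) then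
        (ArithmeticFunction.moebius e : ℝ) * Real.log ((m : ℝ) / (e : ℝ)) else 0)
    = Real.log m * ((∑ e ∈ m.divisors, if (e : ℝ) ≤ y₂ then (ArithmeticFunction.moebius e : ℝ) else 0)
        - (∑ e ∈ m.divisors, if (e : ℝ) ≤ y₁ then (ArithmeticFunction.moebius e : ℝ) else 0))
      - ((∑ e ∈ m.divisors, if (e : ℝ) ≤ y₂ then
            (ArithmeticFunction.moebius e : ℝ) * Real.log e else 0)
        - (∑ e ∈ m.divisors, if (e : ℝ) ≤ y₁ then
            (ArithmeticFunction.moebius e : ℝ) * Real.log e else 0)) := by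
  rw [mul_sub, Finset.mul_sum, Finset.mul_sum, ← Finset.sum_sub_distrib,
    ← Finset.sum_sub_distrib, ← Finset.sum_sub_distrib, ← Finset.sum_sub_distrib]
  refine Finset.sum_congr rfl fun e he => ?_
  have hm : (m : ℝ) ≠ 0 := Nat.cast_ne_zero.mpr (Nat.mem_divisors.mp he).2
  have he0 : (e : ℝ) ≠ 0 := Nat.cast_ne_zero.mpr (Nat.pos_of_mem_divisors he).ne'
  rw [Real.log_div hm he0]
  by_cases h1 : y₁ < (e : ℝ) <;> by_cases h2 : y₂ < (e : ℝ)
  · rw [if_pos h1, if_pos h2, if_neg (not_le.mpr h2), if_neg (not_le.mpr h1),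
      if_neg (not_le.mpr h2), if_neg (not_le.mpr h1)]
    ring
  · rw [if_pos h1, if_neg h2, if_pos (not_lt.mp h2), if_neg (not_le.mpr h1),
      if_pos (not_lt.mp h2), if_neg (not_le.mpr h1)]
    ring
  · rw [if_neg h1, if_pos h2, if_neg (not_le.mpr h2), if_pos (not_lt.mp h1),
      if_neg (not_le.mpr h2), if_pos (not_lt.mp h1)]
    ring
  · rw [if_neg h1, if_neg h2, if_pos (not_lt.mp h2), if_pos (not_lt.mp h1),
      if_pos (not_lt.mp h2), if_pos (not_lt.mp h1)]
    ring

/-- At an argument `n` with `g(n) ≥ 1`, a truncated divisor sum is a sum over `[1, ⌊y⌋]` against the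
indicator of `e ∣ g(n)`. [folklore] -/
theorem divisor_sum_eq_Icc (g : ℤ[X]) (w : ℕ → ℝ) {n : ℕ} (hn : 1 ≤ (g.eval (n : ℤ)).toNat)
    {y : ℝ} (hy : 0 ≤ y) :
    (∑ e ∈ ((g.eval (n : ℤ)).toNat).divisors, if (e : ℝ) ≤ y then w e else 0)
      = ∑ e ∈ Icc 1 ⌊y⌋₊, w e * (if ((e : ℕ) : ℤ) ∣ g.eval (n : ℤ) then 1 else 0) := by
  have hcast : g.eval (n : ℤ) = (((g.eval (n : ℤ)).toNat : ℕ) : ℤ) :=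
    (Int.toNat_of_nonneg (by omega)).symm
  have hdvd : ∀ e : ℕ, (((e : ℕ) : ℤ) ∣ g.eval (n : ℤ)) ↔ e ∣ (g.eval (n : ℤ)).toNat := by
    intro e
    rw [hcast, Int.natCast_dvd_natCast, Int.toNat_natCast]
  have hR : ∑ e ∈ Icc 1 ⌊y⌋₊, w e * (if ((e : ℕ) : ℤ) ∣ g.eval (n : ℤ) then 1 else 0)
      = ∑ e ∈ (Icc 1 ⌊y⌋₊).filter (fun e => ((e : ℕ) : ℤ) ∣ g.eval (n : ℤ)), w e := by
    rw [Finset.sum_filter]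
    refine Finset.sum_congr rfl fun e _ => ?_
    split_ifs <;> ring
  rw [hR, ← Finset.sum_filter]
  refine Finset.sum_congr ?_ fun _ _ => rfl
  ext e
  simp only [Finset.mem_filter, Nat.mem_divisors, Finset.mem_Icc, hdvd]
  constructor
  · rintro ⟨⟨hd, hm⟩, hle⟩
    refine ⟨⟨Nat.pos_of_dvd_of_pos hd (Nat.pos_of_ne_zero hm), (Nat.le_floor_iff hy).mpr hle⟩, hd⟩
  · rintro ⟨⟨h1, h2⟩, hd⟩
    exact ⟨⟨hd, by omega⟩, (Nat.le_floor_iff hy).mp h2⟩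

/-- Periodicity of the divisibility pattern `e ∣ g(n)` in `n` with period `e`. [folklore] -/
theorem dvd_eval_periodic (g : ℤ[X]) (e n : ℕ) :
    ((e : ℤ) ∣ g.eval (((n + e : ℕ) : ℤ))) ↔ ((e : ℤ) ∣ g.eval (n : ℤ)) := by
  refine dvd_iff_dvd_of_dvd_sub ?_
  refine dvd_trans ?_ (Polynomial.sub_dvd_eval_sub _ _ _)
  push_cast
  simp


/-! ### Assembly for `k = 1` -/

/-- Triangle-inequality bookkeeping for the four main/error terms of the `k = 1` strip. [folklore] -/
theorem abs_combo_le (u₂ u₁ p₂ p₁ X q₂ q₁ r₂ r₁ X₀ : ℝ) (hX : 0 ≤ X) (hX₀ : 0 ≤ X₀) :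
    |(u₂ - u₁) - (q₂ - q₁)|
      ≤ |u₂ - X * p₂| + |u₁ - X * p₁| + X * (|p₂| + |p₁|)
        + |q₂ - X₀ * r₂| + |q₁ - X₀ * r₁| + X₀ * |r₂ - r₁| := by
  have h1 := le_abs_self (u₂ - X * p₂)
  have h1' := neg_abs_le (u₂ - X * p₂)
  have h2 := le_abs_self (u₁ - X * p₁)
  have h2' := neg_abs_le (u₁ - X * p₁)
  have h3 := le_abs_self (q₂ - X₀ * r₂)
  have h3' := neg_abs_le (q₂ - X₀ * r₂)
  have h4 := le_abs_self (q₁ - X₀ * r₁)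
  have h4' := neg_abs_le (q₁ - X₀ * r₁)
  have h5 : X * p₂ ≤ X * |p₂| := mul_le_mul_of_nonneg_left (le_abs_self _) hX
  have h5' : -(X * |p₂|) ≤ X * p₂ := by
    have := mul_le_mul_of_nonneg_left (neg_abs_le p₂) hX
    linarith
  have h6 : X * p₁ ≤ X * |p₁| := mul_le_mul_of_nonneg_left (le_abs_self _) hX
  have h6' : -(X * |p₁|) ≤ X * p₁ := by
    have := mul_le_mul_of_nonneg_left (neg_abs_le p₁) hX
    linarith
  have h7 : X₀ * (r₂ - r₁) ≤ X₀ * |r₂ - r₁| := mul_le_mul_of_nonneg_left (le_abs_self _) hX₀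
  have h7' : -(X₀ * |r₂ - r₁|) ≤ X₀ * (r₂ - r₁) := by
    have := mul_le_mul_of_nonneg_left (neg_abs_le (r₂ - r₁)) hX₀
    linarith
  have e : (u₂ - u₁) - (q₂ - q₁) = (u₂ - X * p₂) - (u₁ - X * p₁) + (X * p₂ - X * p₁)
      - ((q₂ - X₀ * r₂) - (q₁ - X₀ * r₁)) - X₀ * (r₂ - r₁) := by ring
  rw [abs_le]
  constructor <;> linarith


/-- The `U`-form of the strip over `n ≥ N₀`: after the pointwise expansion and the passage to the box
`[1, ⌊y⌋]`, `Σ_{N₀≤n≤x} (tail(n,y₁) − tail(n,y₂)) = (U₁(y₂) − U₁(y₁)) − (U₀(y₂) − U₀(y₁))`. [folklore] -/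
theorem stub_U_identity :
    ∀ (g : ℤ[X]) {N₀ x : ℕ} (h1 : ∀ n, N₀ ≤ n → 1 ≤ (g.eval (n : ℤ)).toNat) {y₁ y₂ : ℝ} (hy₁ : 0 ≤ y₁) (hy₂ : 0 ≤ y₂),
    ∑ n ∈ Icc N₀ x,
      ((∑ e ∈ ((g.eval (n : ℤ)).toNat).divisors, if y₁ < (e : ℝ) then
          (ArithmeticFunction.moebius e : ℝ) * Real.log ((((g.eval (n : ℤ)).toNat : ℕ) : ℝ) / (e : ℝ))
          else 0)
        - (∑ e ∈ ((g.eval (n : ℤ)).toNat).divisors, if y₂ < (e : ℝ) then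
          (ArithmeticFunction.moebius e : ℝ) * Real.log ((((g.eval (n : ℤ)).toNat : ℕ) : ℝ) / (e : ℝ))
          else 0))
    = ((∑ n ∈ Icc N₀ x, Real.log ((((g.eval (n : ℤ)).toNat : ℕ) : ℝ)) *
          ∑ e ∈ Icc 1 ⌊y₂⌋₊, (ArithmeticFunction.moebius e : ℝ) *
            (if ((e : ℕ) : ℤ) ∣ g.eval (n : ℤ) then 1 else 0))
        - (∑ n ∈ Icc N₀ x, Real.log ((((g.eval (n : ℤ)).toNat : ℕ) : ℝ)) *
          ∑ e ∈ Icc 1 ⌊y₁⌋₊, (ArithmeticFunction.moebius e : ℝ) *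
            (if ((e : ℕ) : ℤ) ∣ g.eval (n : ℤ) then 1 else 0)))
      - ((∑ n ∈ Icc N₀ x, (1 : ℝ) *
          ∑ e ∈ Icc 1 ⌊y₂⌋₊, ((ArithmeticFunction.moebius e : ℝ) * Real.log e) *
            (if ((e : ℕ) : ℤ) ∣ g.eval (n : ℤ) then 1 else 0))
        - (∑ n ∈ Icc N₀ x, (1 : ℝ) *
          ∑ e ∈ Icc 1 ⌊y₁⌋₊, ((ArithmeticFunction.moebius e : ℝ) * Real.log e) *
            (if ((e : ℕ) : ℤ) ∣ g.eval (n : ℤ) then 1 else 0))) := by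
  intro g N₀ x h1 y₁ y₂ hy₁ hy₂
  have hpt : ∀ n ∈ Icc N₀ x,
      ((∑ e ∈ ((g.eval (n : ℤ)).toNat).divisors, if y₁ < (e : ℝ) then
          (ArithmeticFunction.moebius e : ℝ) * Real.log ((((g.eval (n : ℤ)).toNat : ℕ) : ℝ) / (e : ℝ))
          else 0)
        - (∑ e ∈ ((g.eval (n : ℤ)).toNat).divisors, if y₂ < (e : ℝ) then
          (ArithmeticFunction.moebius e : ℝ) * Real.log ((((g.eval (n : ℤ)).toNat : ℕ) : ℝ) / (e : ℝ))
          else 0))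
      = Real.log ((((g.eval (n : ℤ)).toNat : ℕ) : ℝ)) *
          ((∑ e ∈ Icc 1 ⌊y₂⌋₊, (ArithmeticFunction.moebius e : ℝ) *
              (if ((e : ℕ) : ℤ) ∣ g.eval (n : ℤ) then 1 else 0))
            - (∑ e ∈ Icc 1 ⌊y₁⌋₊, (ArithmeticFunction.moebius e : ℝ) *
              (if ((e : ℕ) : ℤ) ∣ g.eval (n : ℤ) then 1 else 0)))
        - ((∑ e ∈ Icc 1 ⌊y₂⌋₊, ((ArithmeticFunction.moebius e : ℝ) * Real.log e) *
              (if ((e : ℕ) : ℤ) ∣ g.eval (n : ℤ) then 1 else 0))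
            - (∑ e ∈ Icc 1 ⌊y₁⌋₊, ((ArithmeticFunction.moebius e : ℝ) * Real.log e) *
              (if ((e : ℕ) : ℤ) ∣ g.eval (n : ℤ) then 1 else 0))) := by
    intro n hn
    have hn1 : 1 ≤ (g.eval (n : ℤ)).toNat := h1 n (Finset.mem_Icc.mp hn).1
    rw [pointwise_fin_one, divisor_sum_eq_Icc g _ hn1 hy₂, divisor_sum_eq_Icc g _ hn1 hy₁,
      divisor_sum_eq_Icc g _ hn1 hy₂, divisor_sum_eq_Icc g _ hn1 hy₁]
  rw [Finset.sum_congr rfl hpt]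
  simp only [mul_sub, Finset.sum_sub_distrib, one_mul]

end Summit.Parity.BatemanHorn.Theorems.PolyMobiusTail.NaturalForm.StripFinOne
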